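import Summits.CriticalPhenomena.Ising3DConformalLimit.Theorems.InverseSquareTelemetryInverseSquareLawTelemetricLimitEta
import Literature.Probability.LatticeModels.CriticalTwoPointDCPLowerHolds
import HarnessLib

/-!
# Crux `InverseSquareLaw` (stmt-CriticalPhenomena-4495), line `registered` — the stubs are
# NECESSARY, and the telemetric constant is at most `3/4`

Route `InverseSquareTelemetry`, sub-problem `Ising3DConformalLimit`; THEOREM-ONLY helper file,
`--supports stmt-CriticalPhenomena-4495` (lead c3 of the line).

Write `G = criticalTwoPoint 3`, `s(x) = ∑ᵢ xᵢ²`, `T(x) = s(x) · (Δ_{ℤ³}G)(x)/G(x)` (the telemetry,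
kept verbatim in every statement). The registered skeleton `Cruxes/InverseSquareLaw/Lines/birth.lean`
proves the crux `InverseSquareLaw` (`∃ κ ≥ 0, ε > 0, C, ∀ x ≠ 0, |T(x) − κ| ≤ C |x|₂^{−ε}`) from its
two open stubs S1 `stub_telemetricLimit` (`∃ κ, T → κ` cofinitely) and S3 `stub_diniRate` (rate
given the limit). This file records the CONVERSES and a sharpening, all kernel-checked:

* `telemetricLimit_of_inverseSquareLaw` — the crux implies S1 verbatim (`|x|₂^{−ε} → 0` along the
  cofinite filter of `ℤ³`);
* `telemetricDiniRate_of_inverseSquareLaw` — the crux implies S3 verbatim (uniqueness of cofinite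
  limits identifies S3's `κ` with the crux's);
  hence `InverseSquareLaw ↔ S1 ∧ S3` (`inverseSquareLaw_iff_stubs`): the decomposition loses
  nothing, and promoting S1 (the rate-free inverse-square law) to an item is faithful;
* `telemetricLimit_le_three_quarters` — if `T → κ` (S1, NO rate) then `κ ≤ 3/4`: by lead c2's
  `hasIsingExponentEta_of_telemetricLimit` the limit gives `HasIsingExponentEta 3 η` with
  `η = (√(1+4κ) − 1)/2`, and Duminil-Copin–Panis 2025, Thm 1.5 (`dcp_isingEta_le_half_holds`, a
  tree theorem) gives `η ≤ 1/2`, i.e. `√(1+4κ) ≤ 2`; with `telemetricLimit_nonneg` the rate-free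
  window is `κ ∈ [0, 3/4]` (`telemetricLimit_mem_Icc_sharp`), sharpening c2's `[0, 2]`;
* `inverseSquareLaw_iff_sharp` — consequently the crux is equivalent to its sharpened form with
  `0 ≤ κ ≤ 3/4` (CFT reading: `κ = η(1+η)`, `0 ≤ η ≤ 1/2`; conjecturally `κ ≈ 0.0376`).
-/

noncomputable section

namespace Summit.CriticalPhenomena.Ising3DConformalLimit.Theorems

open Literature.Probability.LatticeModels Finset Set Filter Topology
open Summit.CriticalPhenomena.Ising3DConformalLimit.Theorems.EtaBoundsFromTelemetry
open Summit.CriticalPhenomena.Ising3DConformalLimit.Theses.InverseSquareTelemetry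

namespace TelemetricNecessity

/-- `|x|₂^{−ε} = (√s(x))^{−ε} → 0` along the cofinite filter of `ℤ³` for `ε > 0`. [folklore] -/
theorem tendsto_sqrt_sumSq_rpow_neg {ε : ℝ} (hε : 0 < ε) :
    Tendsto (fun x : Site 3 => Real.sqrt (∑ i, ((x i : ℤ) : ℝ) ^ 2) ^ (-ε)) cofinite (𝓝 0) := by
  have h1 : Tendsto (fun x : Site 3 => Real.sqrt (∑ i, ((x i : ℤ) : ℝ) ^ 2)) cofinite atTop :=
    Real.tendsto_sqrt_atTop.comp tendsto_sumSq_cofinite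
  exact (tendsto_rpow_neg_atTop hε).comp h1

/-- A uniform power bound `|T x − κ| ≤ C |x|₂^{−ε}` off the origin forces `T → κ` cofinitely.
[folklore] -/
theorem tendsto_of_rate {T : Site 3 → ℝ} {κ ε C : ℝ} (hε : 0 < ε)
    (h : ∀ x : Site 3, x ≠ 0 → |T x - κ| ≤ C * Real.sqrt (∑ i, ((x i : ℤ) : ℝ) ^ 2) ^ (-ε)) :
    Tendsto T cofinite (𝓝 κ) := by
  have h0 : Tendsto (fun x : Site 3 => C * Real.sqrt (∑ i, ((x i : ℤ) : ℝ) ^ 2) ^ (-ε))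
      cofinite (𝓝 0) := by
    simpa only [mul_zero] using (tendsto_sqrt_sumSq_rpow_neg hε).const_mul C
  have hev : ∀ᶠ x : Site 3 in cofinite, |T x - κ| ≤ C * Real.sqrt (∑ i, ((x i : ℤ) : ℝ) ^ 2) ^ (-ε) := by
    have hfin : Set.Finite {x : Site 3 | x = 0} := by
      simpa only [Set.setOf_eq_eq_singleton] using Set.finite_singleton (0 : Site 3)
    filter_upwards [hfin.compl_mem_cofinite] with x hx
    exact h x hx
  rw [tendsto_iff_norm_sub_tendsto_zero]
  refine squeeze_zero_norm' ?_ h0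
  filter_upwards [hev] with x hx
  simpa only [Real.norm_eq_abs, abs_abs] using hx

end TelemetricNecessity

open TelemetricNecessity TelemetricWindow

/-- **The crux implies stub S1 (verbatim).** `InverseSquareLaw` gives a `κ` with
`|T(x) − κ| ≤ C|x|₂^{−ε}` off the origin, and `|x|₂^{−ε} → 0` cofinitely on `ℤ³`, so `T → κ`.
[folklore] -/
theorem telemetricLimit_of_inverseSquareLaw (h : InverseSquareLaw) :
    ∃ κ : ℝ, Filter.Tendsto (fun x : Literature.Probability.LatticeModels.Site 3 => (∑ i, ((x i : ℝ)) ^ 2) * (((∑ i : Fin 3, (Literature.Probability.LatticeModels.criticalTwoPoint 3 (x + Pi.single i 1) + Literature.Probability.LatticeModels.criticalTwoPoint 3 (x - Pi.single i 1))) - 6 * Literature.Probability.LatticeModels.criticalTwoPoint 3 x) / Literature.Probability.LatticeModels.criticalTwoPoint 3 x)) Filter.cofinite (nhds κ) := by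
  obtain ⟨κ, ε, C, -, hε, hb⟩ := h
  exact ⟨κ, tendsto_of_rate hε hb⟩

/-- **The crux implies stub S3 (verbatim).** If `T → κ'` and the crux holds with constant `κ`,
then `κ' = κ` (cofinite limits on the infinite type `ℤ³` are unique), so the crux's uniform bound
is an eventual Dini bound for `κ'`. [folklore] -/
theorem telemetricDiniRate_of_inverseSquareLaw (h : InverseSquareLaw) :
    ∀ κ : ℝ, Filter.Tendsto (fun x : Literature.Probability.LatticeModels.Site 3 => (∑ i, ((x i : ℝ)) ^ 2) * (((∑ i : Fin 3, (Literature.Probability.LatticeModels.criticalTwoPoint 3 (x + Pi.single i 1) + Literature.Probability.LatticeModels.criticalTwoPoint 3 (x - Pi.single i 1))) - 6 * Literature.Probability.LatticeModels.criticalTwoPoint 3 x) / Literature.Probability.LatticeModels.criticalTwoPoint 3 x)) Filter.cofinite (nhds κ) → ∃ ε C : ℝ, 0 < ε ∧ ∀ᶠ x : Literature.Probability.LatticeModels.Site 3 in Filter.cofinite, |(∑ i, ((x i : ℝ)) ^ 2) * (((∑ i : Fin 3, (Literature.Probability.LatticeModels.criticalTwoPoint 3 (x + Pi.single i 1) + Literature.Probability.LatticeModels.criticalTwoPoint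 3 (x - Pi.single i 1))) - 6 * Literature.Probability.LatticeModels.criticalTwoPoint 3 x) / Literature.Probability.LatticeModels.criticalTwoPoint 3 x) - κ| ≤ C * Real.sqrt (∑ i, ((x i : ℝ)) ^ 2) ^ (-ε) := by
  intro κ' hκ'
  obtain ⟨κ, ε, C, -, hε, hb⟩ := h
  have hκ : κ' = κ := tendsto_nhds_unique hκ' (tendsto_of_rate hε hb)
  subst hκ
  refine ⟨ε, C, hε, ?_⟩
  have hfin : Set.Finite {x : Site 3 | x = 0} := by
    simpa only [Set.setOf_eq_eq_singleton] using Set.finite_singleton (0 : Site 3)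
  filter_upwards [hfin.compl_mem_cofinite] with x hx
  exact hb x hx

/-- **`InverseSquareLaw ↔ S1 ∧ S3`.** The registered decomposition of the crux into the rate-free
telemetric limit (S1) and the conditional Dini rate (S3) is EXACT: the composition
`S1 → S3 → InverseSquareLaw` of `Lines/birth.lean` (sign from the landed S2
`stub_unitarityFromInfraredBound`, near-field patch) and the two converses above. [folklore] -/
theorem inverseSquareLaw_iff_stubs :
    InverseSquareLaw ↔
      ((∃ κ : ℝ, Filter.Tendsto (fun x : Literature.Probability.LatticeModels.Site 3 => (∑ i, ((x i : ℝ)) ^ 2) * (((∑ i : Fin 3, (Literature.Probability.LatticeModels.criticalTwoPoint 3 (x + Pi.single i 1) + Literature.Probability.LatticeModels.criticalTwoPoint 3 (x - Pi.single i 1))) - 6 * Literature.Probability.LatticeModels.criticalTwoPoint 3 x) / Literature.Probability.LatticeModels.criticalTwoPoint 3 x)) Filter.cofinite (nhds κ)) ∧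
       (∀ κ : ℝ, Filter.Tendsto (fun x : Literature.Probability.LatticeModels.Site 3 => (∑ i, ((x i : ℝ)) ^ 2) * (((∑ i : Fin 3, (Literature.Probability.LatticeModels.criticalTwoPoint 3 (x + Pi.single i 1) + Literature.Probability.LatticeModels.criticalTwoPoint 3 (x - Pi.single i 1))) - 6 * Literature.Probability.LatticeModels.criticalTwoPoint 3 x) / Literature.Probability.LatticeModels.criticalTwoPoint 3 x)) Filter.cofinite (nhds κ) → ∃ ε C : ℝ, 0 < ε ∧ ∀ᶠ x : Literature.Probability.LatticeModels.Site 3 in Filter.cofinite, |(∑ i, ((x i : ℝ)) ^ 2) * (((∑ i : Fin 3, (Literature.Probability.LatticeModels.criticalTwoPoint 3 (x + Pi.single i 1) + Literature.Probability.LatticeModels.criticalTwoPoint 3 (x - Pi.single i 1))) - 6 * Literature.Probability.LatticeModels.criticalTwoPoint 3 x) / Literature.Probability.LatticeModels.criticalTwoPoint 3 x) - κ| ≤ C * Real.sqrt (∑ i, ((x i : ℝ)) ^ 2) ^ (-ε))) := by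
  constructor
  · exact fun h => ⟨telemetricLimit_of_inverseSquareLaw h, telemetricDiniRate_of_inverseSquareLaw h⟩
  · rintro ⟨⟨κ, hκ⟩, h3⟩
    obtain ⟨ε, C, hε, hev⟩ := h3 κ hκ
    have h2 : 0 ≤ κ := stub_unitarityFromInfraredBound κ ε C hε hev
    -- near-field patch: the exceptional set is finite and `|x|₂^{-ε} > 0` off the origin
    obtain ⟨M, _hM0, hM⟩ := EtaBoundsFromTelemetry.exists_le_mul_on_finite
      (Filter.eventually_cofinite.1 hev)
      (fun x => |(∑ i, ((x i : ℝ)) ^ 2) * (((∑ i : Fin 3, (criticalTwoPoint 3 (x + Pi.single i 1) +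
        criticalTwoPoint 3 (x - Pi.single i 1))) - 6 * criticalTwoPoint 3 x) / criticalTwoPoint 3 x) - κ|)
      (fun x => Real.sqrt (∑ i, ((x i : ℝ)) ^ 2) ^ (-ε))
    refine ⟨κ, ε, max C M, h2, hε, fun x hx => ?_⟩
    have hs : 0 < Real.sqrt (∑ i, ((x i : ℝ)) ^ 2) :=
      Real.sqrt_pos.2 (lt_of_lt_of_le one_pos (PerfectScreening.one_le_sum_sq hx))
    have hg : 0 < Real.sqrt (∑ i, ((x i : ℝ)) ^ 2) ^ (-ε) := Real.rpow_pos_of_pos hs _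
    by_cases hxF : |(∑ i, ((x i : ℝ)) ^ 2) * (((∑ i : Fin 3, (criticalTwoPoint 3 (x + Pi.single i 1) +
        criticalTwoPoint 3 (x - Pi.single i 1))) - 6 * criticalTwoPoint 3 x) / criticalTwoPoint 3 x) - κ| ≤
        C * Real.sqrt (∑ i, ((x i : ℝ)) ^ 2) ^ (-ε)
    · exact hxF.trans (mul_le_mul_of_nonneg_right (le_max_left C M) hg.le)
    · exact (hM x hxF hg).trans (mul_le_mul_of_nonneg_right (le_max_right C M) hg.le)

/-- **The rate-free telemetric constant is at most `3/4`.** If `T → κ` cofinitely (stub S1, NO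
rate), then `κ ≤ 3/4`: the limit gives `HasIsingExponentEta 3 ((√(1+4κ) − 1)/2)`
(`hasIsingExponentEta_of_telemetricLimit`), and Duminil-Copin–Panis 2025, Thm 1.5
(`dcp_isingEta_le_half_holds`) bounds every such `η` by `1/2`, i.e. `√(1+4κ) ≤ 2`. [folklore] -/
theorem telemetricLimit_le_three_quarters {κ : ℝ}
    (hlim : Filter.Tendsto (fun x : Literature.Probability.LatticeModels.Site 3 => (∑ i, ((x i : ℝ)) ^ 2) * (((∑ i : Fin 3, (Literature.Probability.LatticeModels.criticalTwoPoint 3 (x + Pi.single i 1) + Literature.Probability.LatticeModels.criticalTwoPoint 3 (x - Pi.single i 1))) - 6 * Literature.Probability.LatticeModels.criticalTwoPoint 3 x) / Literature.Probability.LatticeModels.criticalTwoPoint 3 x)) Filter.cofinite (nhds κ)) :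
    κ ≤ 3 / 4 := by
  have hκ0 : 0 ≤ κ := telemetricLimit_nonneg hlim
  have hη : (Real.sqrt (1 + 4 * κ) - 1) / 2 ≤ 1 / 2 :=
    dcp_isingEta_le_half_holds _ (hasIsingExponentEta_of_telemetricLimit hlim)
  have hr : Real.sqrt (1 + 4 * κ) ≤ 2 := by linarith
  have hsq : 1 + 4 * κ ≤ 4 := by
    have h := Real.sq_sqrt (show (0 : ℝ) ≤ 1 + 4 * κ by linarith)
    nlinarith [Real.sqrt_nonneg (1 + 4 * κ)]
  linarith

/-- **The sharp rate-free window `κ ∈ [0, 3/4]`** for the telemetric limit of stub S1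
(`telemetricLimit_nonneg` from the infrared bound, `telemetricLimit_le_three_quarters` from
`η ≤ 1/2`); sharpens `telemetricLimit_mem_Icc` (`[0, 2]`). [folklore] -/
theorem telemetricLimit_mem_Icc_sharp {κ : ℝ}
    (hlim : Filter.Tendsto (fun x : Literature.Probability.LatticeModels.Site 3 => (∑ i, ((x i : ℝ)) ^ 2) * (((∑ i : Fin 3, (Literature.Probability.LatticeModels.criticalTwoPoint 3 (x + Pi.single i 1) + Literature.Probability.LatticeModels.criticalTwoPoint 3 (x - Pi.single i 1))) - 6 * Literature.Probability.LatticeModels.criticalTwoPoint 3 x) / Literature.Probability.LatticeModels.criticalTwoPoint 3 x)) Filter.cofinite (nhds κ)) :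
    κ ∈ Set.Icc (0 : ℝ) (3 / 4) :=
  ⟨telemetricLimit_nonneg hlim, telemetricLimit_le_three_quarters hlim⟩

/-- **The crux is equivalent to its sharpened form `0 ≤ κ ≤ 3/4`.** Any witness `κ` of
`InverseSquareLaw` is the cofinite limit of the telemetry, hence lies in `[0, 3/4]`. [folklore] -/
theorem inverseSquareLaw_iff_sharp :
    InverseSquareLaw ↔
      ∃ κ ε C : ℝ, 0 ≤ κ ∧ κ ≤ 3 / 4 ∧ 0 < ε ∧ ∀ x : Literature.Probability.LatticeModels.Site 3, x ≠ 0 → |(∑ i, ((x i : ℝ)) ^ 2) * (((∑ i : Fin 3, (Literature.Probability.LatticeModels.criticalTwoPoint 3 (x + Pi.single i 1) + Literature.Probability.LatticeModels.criticalTwoPoint 3 (x - Pi.single i 1))) - 6 * Literature.Probability.LatticeModels.criticalTwoPoint 3 x) / Literature.Probability.LatticeModels.criticalTwoPoint 3 x) - κ| ≤ C * Real.sqrt (∑ i, ((x i : ℝ)) ^ 2) ^ (-ε) := by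
  constructor
  · rintro ⟨κ, ε, C, hκ, hε, hb⟩
    exact ⟨κ, ε, C, hκ, telemetricLimit_le_three_quarters (tendsto_of_rate hε hb), hε, hb⟩
  · rintro ⟨κ, ε, C, hκ, -, hε, hb⟩
    exact ⟨κ, ε, C, hκ, hε, hb⟩

end Summit.CriticalPhenomena.Ising3DConformalLimit.Theorems
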